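import Literature.Computability.QuantumComplexity.PerSearchGridBrick
import Literature.Computability.Complexity.CapBricks
import HarnessLib

/-!
# The pre-phase of a level of the AA13 permanent search as `FP` bricks: value query and pivot scan

Aaronson–Arkhipov, *The computational complexity of linear optics*, Theory of Computing 9 (2013),
proof of Thm. 4.3 (p. 176): "we can check in polynomial time whether `Per(X) = 0` … there exists a
permutation `σ` such that `x_{1,σ(1)} = ⋯ = x_{n,σ(n)} = 1`. By permuting the rows …". In the tree the
pre-phase of a level is `PerSearch.levelPre mk X` (`PermanentSearchReplay.lean`): ask the value of `X`,
exit on `0`, else scan the rows `p = 0, 1, …` for one with `x_{p0} = 1` whose minor has nonzero value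
(`pivotTest`), the scan on transcripts being the fuelled recursion `pivScan mk X fuel j as`
(`replay_levelPre`, `replay_firstM_pivot`). This file realises it on string records:

* `scEnc w n S as j` — the scan state (status `S`: `ε` scanning, `0` pivot found, `1 q` pending;
  transcript; candidate `1ʲ`; the word `w` of `X = wmat (n+1) w` with its dimension `1^{n+1}`);
* `pivQueryF` — the query of the randomised maker for the pivot-test minor
  `X.submatrix p.succAbove succ = wmat n (minorW n (permW (n+1) w p))` (`submatrix_succAbove_eq_wmat`;
  `permWF`, `minorWF`, `matC` of `PermanentSearchWords.lean`; `pivQueryF_scEnc`);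
* `scanStep` — one candidate — and **`loopModel_scanStep`**: `k` rounds from `scEnc w n ε as j` give the
  code `scOut` of `pivScan (randMaker G c q₀ u) (wmat (n+1) w) k j as` at the final candidate `scanIdx`
  (the machine idles on `j ≥ n + 1` instead of flagging, so "no pivot" keeps the status `ε`);
* `scanLoopF` — the capped counted loop (`Brick.rcapF`, allowance `SSp`: a pending pivot query is the
  code of an `n × n` `0/1` matrix, `≤ LM N 1` symbols, plus coins), in `FP` unconditionally, the cap
  inactive along the invariant `ScInv` (`scanLoopF_apply`);
* `headF G c q₀` — the pre-phase on `⟨inp, ⟨⟨w, 1^{n+1}⟩, ansEnc as⟩⟩`: the value query `valQueryF`, the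
  exit on `0`, the scan and its read-out; **`headF_apply : headF … = headOut w n (replay (levelPre …) as)`**
  with `headOut` the code of the pre-phase outcome (pending `1 q`; exit `00`; pivot `0` with `1ᵖ`, `bin v₀`).

## References

* S. Aaronson, A. Arkhipov, *The computational complexity of linear optics*, Theory of Computing 9
  (2013), proof of Thm. 4.3 (p. 176); Thm. 1.1 (p. 149).
* S. Arora, B. Barak, *Computational Complexity: A Modern Approach*, CUP 2009, §1.3, §3.4.
-/

noncomputable section

namespace Literature.Computability.QuantumComplexity

open _root_.Computability Complexity Complexity.Brick Complexity.Plumb Complexity.OracleComp Matrix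
  Literature.Computability.AlgebraicComplexity Polynomial

namespace PerSearch

/-! ### The scan record -/

/-- **The scan state**: status, transcript, candidate row `1ʲ`, the word and its dimension `1^{n+1}`. [folklore] -/
def scEnc (w : List Bool) (n : ℕ) (S : List Bool) (as : List (List Bool)) (j : ℕ) : List Bool :=
  boolPair S (boolPair (ansEnc as) (boolPair (ones j) (boolPair w (ones (n + 1)))))

/-- Status field of the scan state. [folklore] -/
def sS : List Bool → List Bool := nthF 0
/-- Transcript field. [folklore] -/
def sAS : List Bool → List Bool := nthF 1
/-- Candidate field `1ʲ`. [folklore] -/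
def sJ : List Bool → List Bool := nthF 2
/-- The word. [folklore] -/
def sW : List Bool → List Bool := nthF 3
/-- The dimension `1^{n+1}`. [folklore] -/
def sK : List Bool → List Bool := sndPow 3

section SProj
variable (w : List Bool) (n : ℕ) (S : List Bool) (as : List (List Bool)) (j : ℕ)
/-- Value of `sS`. [folklore] -/
@[simp] theorem sS_scEnc : sS (scEnc w n S as j) = S := by simp [sS, scEnc]
/-- Value of `sAS`. [folklore] -/
@[simp] theorem sAS_scEnc : sAS (scEnc w n S as j) = ansEnc as := by simp [sAS, scEnc, nthF]
/-- Value of `sJ`. [folklore] -/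
@[simp] theorem sJ_scEnc : sJ (scEnc w n S as j) = ones j := by simp [sJ, scEnc, nthF]
/-- Value of `sW`. [folklore] -/
@[simp] theorem sW_scEnc : sW (scEnc w n S as j) = w := by simp [sW, scEnc, nthF]
/-- Value of `sK`. [folklore] -/
@[simp] theorem sK_scEnc : sK (scEnc w n S as j) = ones (n + 1) := by simp [sK, scEnc, sndPow]
/-- The scan state without its status. [folklore] -/
@[simp] theorem sndF_scEnc : sndF (scEnc w n S as j) = boolPair (ansEnc as) (boolPair (ones j) (boolPair w (ones (n + 1)))) := by
  simp [scEnc]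
/-- The tail of the scan state after the transcript. [folklore] -/
@[simp] theorem sndPow_one_scEnc : sndPow 1 (scEnc w n S as j) = boolPair (ones j) (boolPair w (ones (n + 1))) := by
  simp [scEnc, sndPow]
/-- The tail of the scan state after the candidate. [folklore] -/
@[simp] theorem sndPow_two_scEnc : sndPow 2 (scEnc w n S as j) = boolPair w (ones (n + 1)) := by simp [scEnc, sndPow]
end SProj

/-- The projections are in `FP`. [cite: AroraBarak2009, §1.3] -/
theorem sproj_mem_FP : sS ∈ FP ∧ sAS ∈ FP ∧ sJ ∈ FP ∧ sW ∈ FP ∧ sK ∈ FP :=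
  ⟨nthF_mem_FP 0, nthF_mem_FP 1, nthF_mem_FP 2, nthF_mem_FP 3, sndPow_mem_FP 3⟩

/-- On the loop record `⟨inp, ⟨cnt, state⟩⟩`: the state. [folklore] -/
def lSt : List Bool → List Bool := sndPow 1
/-- On the loop record: the decorated query `u` inside the machine input `inp = ⟨u, A⟩`. [folklore] -/
def lU : List Bool → List Bool := fstF ∘ nthF 0

/-- `lSt ∈ FP`. [cite: AroraBarak2009, §1.3] -/
theorem lSt_mem_FP : lSt ∈ FP := sndPow_mem_FP 1
/-- `lU ∈ FP`. [cite: AroraBarak2009, §1.3] -/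
theorem lU_mem_FP : lU ∈ FP := comp_mem_FP fstF_mem_FP (nthF_mem_FP 0)

/-- Value of `lSt` on a loop record. [folklore] -/
@[simp] theorem lSt_rec (inp cnt s : List Bool) : lSt (boolPair inp (boolPair cnt s)) = s := by simp [lSt, sndPow]
/-- Value of `lU` on a loop record with input `⟨u, A⟩`. [folklore] -/
@[simp] theorem lU_rec (u A cnt s : List Bool) : lU (boolPair (boolPair u A) (boolPair cnt s)) = u := by simp [lU, nthF]

/-! ### The pivot-test minor and its query -/

/-- The pivot-test minor of row `p` is the matrix of a word: the minor word of the permuted word. [cite: AaronsonArkhipovToC2013, proof of Thm. 4.3 (p. 176)] -/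
theorem submatrix_succAbove_eq_wmat {n : ℕ} (w : List Bool) (hw : w.length = (n + 1) * (n + 1)) (p : Fin (n + 1)) :
    (wmat (n + 1) w).submatrix p.succAbove Fin.succ = wmat n (minorW n (permW (n + 1) w p)) := by
  rw [submatrix_succAbove_succ, ← wmat_permW w hw p, ← wmat_minorW _ (length_permW hw p.2)]

/-- On the loop record: the word of the pivot-test minor of the candidate row. [folklore] -/
def minorWordF : List Bool → List Bool :=
  minorWF ∘ fanoutFn (permWF ∘ fanoutFn (fanoutFn (sW ∘ lSt) (sK ∘ lSt)) (sJ ∘ lSt)) (dropFn ∘ fanoutFn (fun _ => [true]) (sK ∘ lSt))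

/-- Value of `minorWordF` (`|w| = (n+1)²`, `j < n + 1`). [folklore] -/
theorem minorWordF_rec (inp cnt : List Bool) {n : ℕ} {w : List Bool} (hw : w.length = (n + 1) * (n + 1)) (S : List Bool)
    (as : List (List Bool)) {j : ℕ} (hj : j < n + 1) :
    minorWordF (boolPair inp (boolPair cnt (scEnc w n S as j))) = minorW n (permW (n + 1) w j) := by
  simp only [minorWordF, Function.comp_apply, fanoutFn_apply, lSt_rec, sW_scEnc, sK_scEnc, sJ_scEnc, dropFn_boolPair,
    List.length_singleton]
  rw [permWF_apply w hw hj, show (ones (n + 1)).drop 1 = ones n by simp [ones], minorWF_apply]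

/-- `minorWordF ∈ FP`. [cite: AroraBarak2009, §1.3] -/
theorem minorWordF_mem_FP : minorWordF ∈ FP := by
  obtain ⟨_, _, hJ, hW, hK⟩ := sproj_mem_FP
  have hst : lSt ∈ FP := lSt_mem_FP
  exact comp_mem_FP minorWF_mem_FP (fanoutFn_mem_FP
    (comp_mem_FP permWF_mem_FP (fanoutFn_mem_FP (fanoutFn_mem_FP (comp_mem_FP hW hst) (comp_mem_FP hK hst)) (comp_mem_FP hJ hst)))
    (comp_mem_FP dropFn_mem_FP (fanoutFn_mem_FP (const_mem_FP _) (comp_mem_FP hK hst))))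

/-- On the loop record with input `⟨u, A⟩`: **the argument record of `querF` for the pivot query** —
`⟨⟨inX u, inR u⟩, ⟨matC (minor word), block index of the site (n+1, 1, j, 0)⟩⟩`. [cite: AaronsonArkhipovToC2013, proof of Thm. 4.3 (p. 176) with Thm. 1.1 (p. 149)] -/
def pivArgF (G : ℕ) (q₀ : Polynomial ℕ) : List Bool → List Bool :=
  fanoutFn (fanoutFn (fstF ∘ fstF ∘ lU) (sndF ∘ fstF ∘ lU))
    (fanoutFn (matC ∘ minorWordF)
      (blockIdxF G q₀ ∘ fanoutFn (fstF ∘ fstF ∘ lU) (fanoutFn (lenBinF ∘ fstF ∘ fstF ∘ sndF ∘ lU)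
        (fanoutFn (lenBinF ∘ sK ∘ lSt) (fanoutFn (fun _ => encodeNat 1) (fanoutFn (lenBinF ∘ sJ ∘ lSt) fun _ => encodeNat 0))))))

/-- `pivArgF G q₀ ∈ FP`. [cite: AroraBarak2009, §1.3] -/
theorem pivArgF_mem_FP (G : ℕ) (q₀ : Polynomial ℕ) : pivArgF G q₀ ∈ FP := by
  obtain ⟨_, _, hJ, _, hK⟩ := sproj_mem_FP
  have hst : lSt ∈ FP := lSt_mem_FP
  have hu : lU ∈ FP := lU_mem_FP
  exact fanoutFn_mem_FP
    (fanoutFn_mem_FP (comp_mem_FP fstF_mem_FP (comp_mem_FP fstF_mem_FP hu)) (comp_mem_FP sndF_mem_FP (comp_mem_FP fstF_mem_FP hu)))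
    (fanoutFn_mem_FP (comp_mem_FP matC_mem_FP minorWordF_mem_FP)
      (comp_mem_FP (blockIdxF_mem_FP G q₀) (fanoutFn_mem_FP (comp_mem_FP fstF_mem_FP (comp_mem_FP fstF_mem_FP hu))
        (fanoutFn_mem_FP (comp_mem_FP lenBinF_mem_FP (comp_mem_FP fstF_mem_FP (comp_mem_FP fstF_mem_FP (comp_mem_FP sndF_mem_FP hu))))
          (fanoutFn_mem_FP (comp_mem_FP lenBinF_mem_FP (comp_mem_FP hK hst)) (fanoutFn_mem_FP (const_mem_FP _)
            (fanoutFn_mem_FP (comp_mem_FP lenBinF_mem_FP (comp_mem_FP hJ hst)) (const_mem_FP _))))))))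

/-- **Value of the argument record.** [folklore] -/
theorem pivArgF_rec (G : ℕ) (q₀ : Polynomial ℕ) (u A cnt : List Bool) {n : ℕ} {w : List Bool} (hw : w.length = (n + 1) * (n + 1))
    (S : List Bool) (as : List (List Bool)) {j : ℕ} (hj : j < n + 1) :
    pivArgF G q₀ (boolPair (boolPair u A) (boolPair cnt (scEnc w n S as j))) =
      boolPair (boolPair (inX u) (inR u))
        (boolPair (encodingIntMatrix.encode ⟨n, fun a b => wmat n (minorW n (permW (n + 1) w j)) a b⟩)
          (encodeNat (inI u * (NSp G q₀).eval (inX u).length + siteIdx G q₀ (inX u).length (n + 1, 1, j, 0)))) := by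
  have hmin : matC (minorW n (permW (n + 1) w j)) = encodingIntMatrix.encode ⟨n, fun a b => wmat n (minorW n (permW (n + 1) w j)) a b⟩ :=
    matC_wmat _ (length_minorW (by rw [length_permW hw hj]))
  have hblk := blockIdxF_apply G q₀ (inX u) (inI u) (n + 1, 1, j, 0)
  simp only [pivArgF, Function.comp_apply, fanoutFn_apply, lU_rec, lSt_rec, sK_scEnc, sJ_scEnc, minorWordF_rec _ cnt hw S as hj, hmin,
    lenBinF_apply]
  rw [show (ones (n + 1)).length = n + 1 by simp [ones], show (ones j).length = j by simp [ones]]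
  dsimp only at hblk
  rw [← hblk]
  rfl

/-- **The pivot query** on the loop record. [cite: AaronsonArkhipovToC2013, proof of Thm. 4.3 (p. 176) with Thm. 1.1 (p. 149)] -/
def pivQueryF (G : ℕ) (c q₀ : Polynomial ℕ) : List Bool → List Bool := querF G c q₀ ∘ pivArgF G q₀

/-- `pivQueryF G c q₀ ∈ FP`. [cite: AroraBarak2009, §1.3] -/
theorem pivQueryF_mem_FP (G : ℕ) (c q₀ : Polynomial ℕ) : pivQueryF G c q₀ ∈ FP :=
  comp_mem_FP (querF_mem_FP G c q₀) (pivArgF_mem_FP G q₀)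

/-- **Value of the pivot query brick**: the query of `randMaker G c q₀ u` at the site `(n+1, 1, j, 0)` for the
pivot-test minor (`|w| = (n+1)²`, `j < n + 1`). [cite: AaronsonArkhipovToC2013, proof of Thm. 4.3 (p. 176) with Thm. 1.1 (p. 149)] -/
theorem pivQueryF_rec (G : ℕ) (c q₀ : Polynomial ℕ) (u A cnt : List Bool) {n : ℕ} {w : List Bool} (hw : w.length = (n + 1) * (n + 1))
    (S : List Bool) (as : List (List Bool)) {j : ℕ} (hj : j < n + 1) :
    pivQueryF G c q₀ (boolPair (boolPair u A) (boolPair cnt (scEnc w n S as j))) =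
      randMaker G c q₀ u (n + 1, 1, j, 0) ⟨n, fun a b => (wmat (n + 1) w).submatrix (Fin.succAbove ⟨j, hj⟩) Fin.succ a b⟩ := by
  rw [pivQueryF, Function.comp_apply, pivArgF_rec G q₀ u A cnt hw S as hj, querF_eq_coinMap, submatrix_succAbove_eq_wmat w hw ⟨j, hj⟩]
  rfl

/-! ### One candidate row -/

/-- On the loop record: **the bit test `[x_{j0} = 1]`** (bit `j (n+1)` of the word). [folklore] -/
def bitJT : List Bool → List Bool :=
  eqPairFn ∘ fanoutFn (bitAtFn ∘ fanoutFn (mulUF ∘ fanoutFn (fanoutFn (sW ∘ lSt) (sK ∘ lSt)) (sJ ∘ lSt)) (sW ∘ lSt)) (fun _ => [true])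

/-- Value of the bit test. [folklore] -/
theorem bitJT_rec (inp cnt : List Bool) (n : ℕ) (w : List Bool) (S : List Bool) (as : List (List Bool)) (j : ℕ) :
    bitJT (boolPair inp (boolPair cnt (scEnc w n S as j))) = [w.getD (j * (n + 1)) false] := by
  simp only [bitJT, Function.comp_apply, fanoutFn_apply, lSt_rec, sW_scEnc, sK_scEnc, sJ_scEnc, mulUF_apply, bitAtFn_boolPair,
    eqPairFn_boolPair]
  rw [show (ones (min (j * (n + 1)) w.length)).length = min (j * (n + 1)) w.length by simp [ones], drop_min_length]
  congr 1
  rw [← Bool.decide_eq_true (b := w.getD (j * (n + 1)) false)]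
  exact Bool.decide_congr (take_one_drop_eq_iff w _)

/-- `bitJT ∈ FP`. [cite: AroraBarak2009, §1.3] -/
theorem bitJT_mem_FP : bitJT ∈ FP := by
  obtain ⟨_, _, hJ, hW, hK⟩ := sproj_mem_FP
  have hst : lSt ∈ FP := lSt_mem_FP
  exact comp_mem_FP eqPairFn_mem_FP (fanoutFn_mem_FP (comp_mem_FP bitAtFn_mem_FP (fanoutFn_mem_FP
    (comp_mem_FP mulUF_mem_FP (fanoutFn_mem_FP (fanoutFn_mem_FP (comp_mem_FP hW hst) (comp_mem_FP hK hst)) (comp_mem_FP hJ hst)))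
    (comp_mem_FP hW hst))) (const_mem_FP _))

/-- The bit test reads the entry `(j, 0)` of the matrix of the word: `X j 0 ≠ 1` iff the bit is unset. [folklore] -/
theorem wmat_zero_ne_one_iff {n : ℕ} (w : List Bool) {j : ℕ} (hj : j < n + 1) :
    wmat (n + 1) w ⟨j, hj⟩ 0 ≠ 1 ↔ w.getD (j * (n + 1)) false = false := by
  rw [wmat_apply, Fin.val_zero, Nat.add_zero]
  cases w.getD (j * (n + 1)) false <;> simp

/-- New scan state: keep scanning, next candidate. [folklore] -/
def nextF : List Bool → List Bool :=
  fanoutFn (fun _ => []) (fanoutFn (sAS ∘ lSt) (fanoutFn (List.cons true ∘ sJ ∘ lSt) (sndPow 2 ∘ lSt)))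
/-- New scan state: consume an answer, next candidate. [folklore] -/
def nextConsF : List Bool → List Bool :=
  fanoutFn (fun _ => []) (fanoutFn (ansTlF ∘ sAS ∘ lSt) (fanoutFn (List.cons true ∘ sJ ∘ lSt) (sndPow 2 ∘ lSt)))
/-- New scan state: pivot found (status `0`). [folklore] -/
def foundF : List Bool → List Bool := fanoutFn (fun _ => [false]) (sndF ∘ lSt)
/-- New scan state: consume an answer, pivot found. [folklore] -/
def foundConsF : List Bool → List Bool :=
  fanoutFn (fun _ => [false]) (fanoutFn (ansTlF ∘ sAS ∘ lSt) (sndPow 1 ∘ lSt))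
/-- New scan state: pending with the pivot query. [folklore] -/
def pendSF (G : ℕ) (c q₀ : Polynomial ℕ) : List Bool → List Bool := fanoutFn (List.cons true ∘ pivQueryF G c q₀) (sndF ∘ lSt)

/-- The state builders are in `FP`. [cite: AroraBarak2009, §1.3] -/
theorem builders_mem_FP (G : ℕ) (c q₀ : Polynomial ℕ) :
    nextF ∈ FP ∧ nextConsF ∈ FP ∧ foundF ∈ FP ∧ foundConsF ∈ FP ∧ pendSF G c q₀ ∈ FP := by
  obtain ⟨_, hAS, hJ, _, _⟩ := sproj_mem_FP
  have hst : lSt ∈ FP := lSt_mem_FP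
  exact ⟨fanoutFn_mem_FP (const_mem_FP _) (fanoutFn_mem_FP (comp_mem_FP hAS hst) (fanoutFn_mem_FP (comp_mem_FP (cons_mem_FP true) (comp_mem_FP hJ hst))
      (comp_mem_FP (sndPow_mem_FP 2) hst))),
    fanoutFn_mem_FP (const_mem_FP _) (fanoutFn_mem_FP (comp_mem_FP ansTlF_mem_FP (comp_mem_FP hAS hst))
      (fanoutFn_mem_FP (comp_mem_FP (cons_mem_FP true) (comp_mem_FP hJ hst)) (comp_mem_FP (sndPow_mem_FP 2) hst))),
    fanoutFn_mem_FP (const_mem_FP _) (comp_mem_FP sndF_mem_FP hst),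
    fanoutFn_mem_FP (const_mem_FP _) (fanoutFn_mem_FP (comp_mem_FP ansTlF_mem_FP (comp_mem_FP hAS hst)) (comp_mem_FP (sndPow_mem_FP 1) hst)),
    fanoutFn_mem_FP (comp_mem_FP (cons_mem_FP true) (pivQueryF_mem_FP G c q₀)) (comp_mem_FP sndF_mem_FP hst)⟩

/-- **One candidate row** (the step of `pivScan` on records): idle unless scanning and `j < n + 1`;
`x_{j0} ≠ 1` — next row; `n = 0` — the empty minor is not asked, pivot found; no answer left — pending with
the minor's query; answer `0` — next row; otherwise pivot found. [cite: AaronsonArkhipovToC2013, proof of Thm. 4.3 (p. 176)] -/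
def scanStep (G : ℕ) (c q₀ : Polynomial ℕ) : List Bool → List Bool :=
  iteFn (isNilFn ∘ sS ∘ lSt)
    (iteFn (ltLenF ∘ fanoutFn (sJ ∘ lSt) (sK ∘ lSt))
      (iteFn bitJT
        (iteFn (lenLeOneFn ∘ sK ∘ lSt) foundF
          (iteFn (isNilFn ∘ fstF ∘ sAS ∘ lSt) (pendSF G c q₀)
            (iteFn (isNilFn ∘ canonF ∘ ansHdF ∘ sAS ∘ lSt) nextConsF foundConsF)))
        nextF)
      lSt)
    lSt

/-- `scanStep G c q₀ ∈ FP`. [cite: AroraBarak2009, §1.3] -/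
theorem scanStep_mem_FP (G : ℕ) (c q₀ : Polynomial ℕ) : scanStep G c q₀ ∈ FP := by
  obtain ⟨hS, hAS, hJ, _, hK⟩ := sproj_mem_FP
  obtain ⟨hn, hnc, hf, hfc, hp⟩ := builders_mem_FP G c q₀
  have hst : lSt ∈ FP := lSt_mem_FP
  exact iteFn_mem_FP (comp_mem_FP isNilFn_mem_FP (comp_mem_FP hS hst))
    (iteFn_mem_FP (comp_mem_FP ltLenF_mem_FP (fanoutFn_mem_FP (comp_mem_FP hJ hst) (comp_mem_FP hK hst)))
      (iteFn_mem_FP bitJT_mem_FP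
        (iteFn_mem_FP (comp_mem_FP lenLeOneFn_mem_FP (comp_mem_FP hK hst)) hf
          (iteFn_mem_FP (comp_mem_FP isNilFn_mem_FP (comp_mem_FP fstF_mem_FP (comp_mem_FP hAS hst))) hp
            (iteFn_mem_FP (comp_mem_FP isNilFn_mem_FP (comp_mem_FP canonF_mem_FP (comp_mem_FP ansHdF_mem_FP (comp_mem_FP hAS hst)))) hnc hfc)))
        hn)
      hst)
    hst

section StepValues

variable (G : ℕ) (c q₀ : Polynomial ℕ) (inp cnt : List Bool) (n : ℕ) (w : List Bool)

/-- A state that is not scanning is fixed. [folklore] -/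
theorem scanStep_of_ne_nil {S : List Bool} (hS : S ≠ []) (as : List (List Bool)) (j : ℕ) :
    scanStep G c q₀ (boolPair inp (boolPair cnt (scEnc w n S as j))) = scEnc w n S as j := by
  rw [scanStep, iteFn_apply (b := false) (by simp [isNilFn, hS])]
  simp

/-- Past the last row the scan idles. [folklore] -/
theorem scanStep_of_le (as : List (List Bool)) {j : ℕ} (hj : n + 1 ≤ j) :
    scanStep G c q₀ (boolPair inp (boolPair cnt (scEnc w n [] as j))) = scEnc w n [] as j := by
  rw [scanStep, iteFn_apply (b := true) (by simp [isNilFn]), iteFn_apply (b := false) (by simp [ones]; omega)]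
  simp

/-- A row with `x_{j0} ≠ 1`: next row. [folklore] -/
theorem scanStep_skip (as : List (List Bool)) {j : ℕ} (hj : j < n + 1) (hb : w.getD (j * (n + 1)) false = false) :
    scanStep G c q₀ (boolPair inp (boolPair cnt (scEnc w n [] as j))) = scEnc w n [] as (j + 1) := by
  rw [scanStep, iteFn_apply (b := true) (by simp [isNilFn]), iteFn_apply (b := true) (by simp [ones]; omega),
    iteFn_apply (b := false) (by rw [bitJT_rec, hb])]
  simp only [Bool.false_eq_true, if_false, if_true, nextF, fanoutFn_apply, Function.comp_apply, lSt_rec, sAS_scEnc, sJ_scEnc,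
    sndPow_two_scEnc]
  rfl

/-- A row with `x_{j0} = 1` at dimension `1`: pivot found without a query. [folklore] -/
theorem scanStep_found_zero (as : List (List Bool)) {j : ℕ} (hj : j < n + 1) (hb : w.getD (j * (n + 1)) false = true) (hn : n = 0) :
    scanStep G c q₀ (boolPair inp (boolPair cnt (scEnc w n [] as j))) = scEnc w n [false] as j := by
  rw [scanStep, iteFn_apply (b := true) (by simp [isNilFn]), iteFn_apply (b := true) (by simp [ones]; omega),
    iteFn_apply (b := true) (by rw [bitJT_rec, hb]), iteFn_apply (b := true) (by simp [lenLeOneFn, ones, hn])]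
  simp only [if_true, foundF, fanoutFn_apply, Function.comp_apply, lSt_rec, sndF_scEnc]
  rfl

/-- A row with `x_{j0} = 1`, no answer left: pending with the minor's query. [folklore] -/
theorem scanStep_pending {j : ℕ} (hj : j < n + 1) (hb : w.getD (j * (n + 1)) false = true) (hn : n ≠ 0) :
    scanStep G c q₀ (boolPair inp (boolPair cnt (scEnc w n [] [] j))) =
      scEnc w n (true :: pivQueryF G c q₀ (boolPair inp (boolPair cnt (scEnc w n [] [] j)))) [] j := by
  rw [scanStep, iteFn_apply (b := true) (by simp [isNilFn]), iteFn_apply (b := true) (by simp [ones]; omega),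
    iteFn_apply (b := true) (by rw [bitJT_rec, hb]), iteFn_apply (b := false) (by simp [lenLeOneFn, ones, hn]),
    iteFn_apply (b := true) (by simp)]
  simp only [if_true, Bool.false_eq_true, if_false, pendSF, fanoutFn_apply, Function.comp_apply, lSt_rec, sndF_scEnc]
  rfl

/-- A row with `x_{j0} = 1`, answer `0`: next row. [folklore] -/
theorem scanStep_cons_zero (a : List Bool) (as : List (List Bool)) {j : ℕ} (hj : j < n + 1) (hb : w.getD (j * (n + 1)) false = true)
    (hn : n ≠ 0) (ha : decodeNat a = 0) :
    scanStep G c q₀ (boolPair inp (boolPair cnt (scEnc w n [] (a :: as) j))) = scEnc w n [] as (j + 1) := by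
  rw [scanStep, iteFn_apply (b := true) (by simp [isNilFn]), iteFn_apply (b := true) (by simp [ones]; omega),
    iteFn_apply (b := true) (by rw [bitJT_rec, hb]), iteFn_apply (b := false) (by simp [lenLeOneFn, ones, hn]),
    iteFn_apply (b := false) (by simp),
    iteFn_apply (b := true) (by simp [isNilFn, canonF_eq_encodeNat_decodeNat, ha, (by decide : encodeNat 0 = [])])]
  simp only [if_true, Bool.false_eq_true, if_false, nextConsF, fanoutFn_apply, Function.comp_apply, lSt_rec, sAS_scEnc, sJ_scEnc,
    sndPow_two_scEnc, ansTlF_ansEnc]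
  rfl

/-- A row with `x_{j0} = 1`, nonzero answer: pivot found. [folklore] -/
theorem scanStep_cons_found (a : List Bool) (as : List (List Bool)) {j : ℕ} (hj : j < n + 1) (hb : w.getD (j * (n + 1)) false = true)
    (hn : n ≠ 0) (ha : decodeNat a ≠ 0) :
    scanStep G c q₀ (boolPair inp (boolPair cnt (scEnc w n [] (a :: as) j))) = scEnc w n [false] as j := by
  have hne : encodeNat (decodeNat a) ≠ [] := fun h => ha (by rw [← bitsToNat_encodeNat (decodeNat a), h]; rfl)
  rw [scanStep, iteFn_apply (b := true) (by simp [isNilFn]), iteFn_apply (b := true) (by simp [ones]; omega),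
    iteFn_apply (b := true) (by rw [bitJT_rec, hb]), iteFn_apply (b := false) (by simp [lenLeOneFn, ones, hn]),
    iteFn_apply (b := false) (by simp), iteFn_apply (b := false) (by simp [isNilFn, canonF_eq_encodeNat_decodeNat, hne])]
  simp only [if_true, Bool.false_eq_true, if_false, foundConsF, fanoutFn_apply, Function.comp_apply, lSt_rec, sAS_scEnc,
    sndPow_one_scEnc, ansTlF_ansEnc]
  rfl

end StepValues

/-! ### The rounds of the scan follow `pivScan` -/

/-- **The final candidate of the scan** (the recursion of `pivScan` returning the row index reached). [folklore] -/
def scanIdx {n : ℕ} (X : Matrix (Fin (n + 1)) (Fin (n + 1)) ℤ) : ℕ → ℕ → List (List Bool) → ℕ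
  | 0, j, _ => j
  | f + 1, j, as =>
    if hj : j < n + 1 then
      if X ⟨j, hj⟩ 0 ≠ 1 then scanIdx X f (j + 1) as
      else if n = 0 then j
      else match as with
        | [] => j
        | a :: as' => if decodeNat a = 0 then scanIdx X f (j + 1) as' else j
    else j

/-- One step of `scanIdx` with fuel. [folklore] -/
theorem scanIdx_succ {n : ℕ} (X : Matrix (Fin (n + 1)) (Fin (n + 1)) ℤ) (f j : ℕ) (as : List (List Bool)) :
    scanIdx X (f + 1) j as =
      (if hj : j < n + 1 then
        if X ⟨j, hj⟩ 0 ≠ 1 then scanIdx X f (j + 1) as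
        else if n = 0 then j
        else match as with
          | [] => j
          | a :: as' => if decodeNat a = 0 then scanIdx X f (j + 1) as' else j
      else j) := by
  cases as <;> rfl

/-- **The code of the outcome of `pivScan`** at the final candidate: pending `1 q` (transcript exhausted),
pivot `p` found (status `0`, candidate `1ᵖ`), or still scanning. [folklore] -/
def scOut (w : List Bool) (n : ℕ) : (List Bool ⊕ (Option (Fin (n + 1)) × List (List Bool))) → ℕ → List Bool
  | Sum.inl q, j => scEnc w n (true :: q) [] j
  | Sum.inr (some p, as), _ => scEnc w n [false] as p
  | Sum.inr (none, as), j => scEnc w n [] as j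

/-- States that are not scanning are fixed by the rounds. [folklore] -/
theorem loopModel_scanStep_of_ne_nil (G : ℕ) (c q₀ : Polynomial ℕ) (inp : List Bool) (n : ℕ) (w : List Bool) {S : List Bool} (hS : S ≠ [])
    (as : List (List Bool)) (j : ℕ) : ∀ k : ℕ, loopModel (scanStep G c q₀) inp k (scEnc w n S as j) = scEnc w n S as j
  | 0 => rfl
  | k + 1 => by rw [loopModel, scanStep_of_ne_nil G c q₀ inp _ n w hS, loopModel_scanStep_of_ne_nil G c q₀ inp n w hS as j k]

/-- Past the last row every round idles. [folklore] -/
theorem loopModel_scanStep_idle (G : ℕ) (c q₀ : Polynomial ℕ) (inp : List Bool) (n : ℕ) (w : List Bool) (as : List (List Bool)) {j : ℕ}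
    (hj : n + 1 ≤ j) : ∀ k : ℕ, loopModel (scanStep G c q₀) inp k (scEnc w n [] as j) = scEnc w n [] as j
  | 0 => rfl
  | k + 1 => by rw [loopModel, scanStep_of_le G c q₀ _ _ n w as hj]; exact loopModel_scanStep_idle G c q₀ inp n w as hj k

/-- **The rounds of the scan follow `pivScan`** (input `⟨u, A⟩`, `|w| = (n+1)²`): `k` rounds from the
scanning state at row `j` give the code of `pivScan (randMaker G c q₀ u) (wmat (n+1) w) k j as` at the final
candidate. [cite: AaronsonArkhipovToC2013, proof of Thm. 4.3 (p. 176)] -/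
theorem loopModel_scanStep (G : ℕ) (c q₀ : Polynomial ℕ) (u A : List Bool) {n : ℕ} {w : List Bool} (hw : w.length = (n + 1) * (n + 1)) :
    ∀ (k j : ℕ) (as : List (List Bool)),
      loopModel (scanStep G c q₀) (boolPair u A) k (scEnc w n [] as j) =
        scOut w n (pivScan (randMaker G c q₀ u) (wmat (n + 1) w) k j as) (scanIdx (wmat (n + 1) w) k j as)
  | 0, j, as => rfl
  | k + 1, j, as => by
    rw [loopModel, pivScan, scanIdx_succ]
    by_cases hj : j < n + 1
    · rw [dif_pos hj, dif_pos hj]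
      by_cases hb : w.getD (j * (n + 1)) false = false
      · have h1 : wmat (n + 1) w ⟨j, hj⟩ 0 ≠ 1 := (wmat_zero_ne_one_iff w hj).2 hb
        rw [if_pos h1, if_pos h1, scanStep_skip G c q₀ _ _ n w as hj hb]
        exact loopModel_scanStep G c q₀ u A hw k (j + 1) as
      · have hb' : w.getD (j * (n + 1)) false = true := by simpa using hb
        have h1 : ¬ wmat (n + 1) w ⟨j, hj⟩ 0 ≠ 1 := fun h => hb ((wmat_zero_ne_one_iff w hj).1 h)
        rw [if_neg h1, if_neg h1]
        by_cases hn : n = 0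
        · rw [if_pos hn, if_pos hn, scanStep_found_zero G c q₀ _ _ n w as hj hb' hn]
          exact loopModel_scanStep_of_ne_nil G c q₀ _ n w (List.cons_ne_nil _ _) as j k
        · rw [if_neg hn, if_neg hn]
          cases as with
          | nil =>
            dsimp only
            rw [scanStep_pending G c q₀ _ _ n w hj hb' hn, pivQueryF_rec G c q₀ u A _ hw [] [] hj,
              loopModel_scanStep_of_ne_nil G c q₀ _ n w (List.cons_ne_nil _ _)]
            rfl
          | cons a as' =>
            dsimp only
            by_cases ha : decodeNat a = 0
            · rw [if_pos ha, if_pos ha, scanStep_cons_zero G c q₀ _ _ n w a as' hj hb' hn ha]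
              exact loopModel_scanStep G c q₀ u A hw k (j + 1) as'
            · rw [if_neg ha, if_neg ha, scanStep_cons_found G c q₀ _ _ n w a as' hj hb' hn ha]
              exact loopModel_scanStep_of_ne_nil G c q₀ _ n w (List.cons_ne_nil _ _) as' j k
    · rw [dif_neg hj, dif_neg hj, scanStep_of_le G c q₀ _ _ n w as (not_lt.1 hj)]
      exact loopModel_scanStep_idle G c q₀ _ n w as (not_lt.1 hj) k

/-! ### The capped scan loop -/

/-- Length of a scan state. [folklore] -/
theorem length_scEnc (w : List Bool) (n : ℕ) (S : List Bool) (as : List (List Bool)) (j : ℕ) :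
    (scEnc w n S as j).length = 2 * S.length + 2 + (2 * (ansEnc as).length + 2 + (2 * j + 2 + (2 * w.length + 2 + (n + 1)))) := by
  simp [scEnc, ones]

/-- `LM N 1` (the code length of an `N × N` matrix with one-bit entries) as a polynomial in `N`. [folklore] -/
def LM1p : Polynomial ℕ := 2 * (X + 1) + 2 + (2 * X + 2 + X * (2 * (2 * X + 2 + X * (2 * (1 + 4) + 2)) + 2))

/-- `eval` of `LM1p`. [folklore] -/
@[simp] theorem LM1p_eval (N : ℕ) : LM1p.eval N = LM N 1 := by simp [LM1p, LM]

/-- The bound of a pending pivot query, as a polynomial in `N = |input|`. [folklore] -/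
def qB1p (G : ℕ) (c q₀ : Polynomial ℕ) : Polynomial ℕ := 2 * (2 * LM1p + 2 + kp G q₀) + 2 + ellp G c q₀

/-- `eval` of `qB1p`. [folklore] -/
theorem qB1p_eval (G : ℕ) (c q₀ : Polynomial ℕ) (N : ℕ) :
    (qB1p G c q₀).eval N = 2 * (2 * LM N 1 + 2 + (kp G q₀).eval N) + 2 + (ellp G c q₀).eval N := by
  simp [qB1p]

/-- **The growth allowance of the scan loop**: twice a pending pivot query (and slack). [folklore] -/
def SSp (G : ℕ) (c q₀ : Polynomial ℕ) : Polynomial ℕ := 2 * (qB1p G c q₀ + 1) + 4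

/-- `eval` of `SSp`. [folklore] -/
theorem SSp_eval (G : ℕ) (c q₀ : Polynomial ℕ) (N : ℕ) : (SSp G c q₀).eval N = 2 * ((qB1p G c q₀).eval N + 1) + 4 := by
  simp [SSp]

/-- **A pending pivot query is polynomially bounded**: the minor is a `0/1` matrix of dimension `n ≤ N`. [cite: AaronsonArkhipovToC2013, proof of Thm. 4.3 (p. 176) with Def. 2.4 (p. 163)] -/
theorem length_pivQuery_le (G : ℕ) (c q₀ : Polynomial ℕ) (u : List Bool) {n N : ℕ} (w : List Bool) {j : ℕ} (hj : j < n + 1)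
    (hnN : n ≤ N) (hx : (inX u).length ≤ N) :
    (randMaker G c q₀ u (n + 1, 1, j, 0) ⟨n, fun a b => (wmat (n + 1) w).submatrix (Fin.succAbove ⟨j, hj⟩) Fin.succ a b⟩).length ≤
      (qB1p G c q₀).eval N := by
  rw [randMaker_apply, length_perSqQuery, qB1p_eval]
  have hM := length_encode_matrix_le (b := 1) (fun a b => (wmat (n + 1) w).submatrix (Fin.succAbove ⟨j, hj⟩) Fin.succ a b)
    (fun a b => by
      have h01 := isZeroOne_wmat (n + 1) w (Fin.succAbove ⟨j, hj⟩ a) (Fin.succ b)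
      simp only [Matrix.submatrix_apply]
      rcases h01 with h | h <;> rw [h] <;> decide)
  have hc := length_chunk_le ((ellp G c q₀).eval (inX u).length)
    (inI u * (NSp G q₀).eval (inX u).length + siteIdx G q₀ (inX u).length (n + 1, 1, j, 0)) (inR u)
  have h1 : LM n 1 ≤ LM N 1 := LM_mono hnN le_rfl
  have h2 : (kp G q₀).eval (inX u).length ≤ (kp G q₀).eval N := TM2Iter.eval_mono _ hx
  have h3 : (ellp G c q₀).eval (inX u).length ≤ (ellp G c q₀).eval N := TM2Iter.eval_mono _ hx
  simp only at hM ⊢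
  omega

/-- **The scan loop**: `|fstF z| + 1` clocked rounds of the capped step. [cite: AaronsonArkhipovToC2013, proof of Thm. 4.3 (p. 176)] -/
def scanLoopF (G : ℕ) (c q₀ : Polynomial ℕ) : List Bool → List Bool := fun z =>
  (loopStep (rcapF (SSp G c q₀) (scanStep G c q₀)))^[(X + 1 : Polynomial ℕ).eval (fstF z).length] z

/-- **`scanLoopF G c q₀ ∈ FP`.** [cite: AroraBarak2009, §1.3 (bounded loops), §1.4.1] -/
theorem scanLoopF_mem_FP (G : ℕ) (c q₀ : Polynomial ℕ) : scanLoopF G c q₀ ∈ FP :=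
  loopFn_rcapF_mem_FP (scanStep_mem_FP G c q₀) (SSp G c q₀) (X + 1)

section SInvariant

variable (G : ℕ) (c q₀ : Polynomial ℕ) (u A : List Bool) (n : ℕ) (w : List Bool) (as₀ : List (List Bool))

/-- **The invariant of the scan loop**: a scan state with a suffix of the initial transcript and a candidate
`≤ n + 1`, whose status is scanning, found, or pending with a query of `≤ qB1p(|inp|)` symbols. [folklore] -/
def ScInv (s : List Bool) : Prop :=
  ∃ (S : List Bool) (as : List (List Bool)) (j : ℕ), s = scEnc w n S as j ∧ as <:+ as₀ ∧ j ≤ n + 1 ∧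
    (S = [] ∨ S = [false] ∨ ∃ q, S = true :: q ∧ q.length ≤ (qB1p G c q₀).eval (boolPair u A).length)

variable {G c q₀ u A n w as₀}
variable (hw : w.length = (n + 1) * (n + 1)) (hnN : n + 1 ≤ (boolPair u A).length)

/-- The initial scanning state satisfies the invariant. [folklore] -/
theorem scinv_init : ScInv G c q₀ u A n w as₀ (scEnc w n [] as₀ 0) := ⟨[], as₀, 0, rfl, List.suffix_refl _, Nat.zero_le _, Or.inl rfl⟩

include hw hnN in
/-- **The step preserves the invariant.** [folklore] -/
theorem scinv_step (k : ℕ) (s : List Bool) (hs : ScInv G c q₀ u A n w as₀ s) :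
    ScInv G c q₀ u A n w as₀ (scanStep G c q₀ (boolPair (boolPair u A) (boolPair (encodeNat (k + 1)) s))) := by
  obtain ⟨S, as, j, rfl, hsuf, hj, hS⟩ := hs
  rcases hS with rfl | rfl | ⟨q, rfl, hq⟩
  · -- scanning
    by_cases hjlt : j < n + 1
    · by_cases hb : w.getD (j * (n + 1)) false = false
      · rw [scanStep_skip G c q₀ _ _ n w as hjlt hb]
        exact ⟨[], as, j + 1, rfl, hsuf, hjlt, Or.inl rfl⟩
      · have hb' : w.getD (j * (n + 1)) false = true := by simpa using hb
        by_cases hn : n = 0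
        · rw [scanStep_found_zero G c q₀ _ _ n w as hjlt hb' hn]
          exact ⟨[false], as, j, rfl, hsuf, hj, Or.inr (Or.inl rfl)⟩
        · cases as with
          | nil =>
            rw [scanStep_pending G c q₀ _ _ n w hjlt hb' hn, pivQueryF_rec G c q₀ u A _ hw [] [] hjlt]
            refine ⟨_, [], j, rfl, List.nil_suffix, hj, Or.inr (Or.inr ⟨_, rfl, ?_⟩)⟩
            exact length_pivQuery_le G c q₀ u w hjlt (by omega) ((length_inX_le u).trans (by rw [length_boolPair]; omega))
          | cons a as' =>
            by_cases ha : decodeNat a = 0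
            · rw [scanStep_cons_zero G c q₀ _ _ n w a as' hjlt hb' hn ha]
              exact ⟨[], as', j + 1, rfl, (List.suffix_cons a as').trans hsuf, hjlt, Or.inl rfl⟩
            · rw [scanStep_cons_found G c q₀ _ _ n w a as' hjlt hb' hn ha]
              exact ⟨[false], as', j, rfl, (List.suffix_cons a as').trans hsuf, hj, Or.inr (Or.inl rfl)⟩
    · rw [scanStep_of_le G c q₀ _ _ n w as (not_lt.1 hjlt)]
      exact ⟨[], as, j, rfl, hsuf, hj, Or.inl rfl⟩
  · rw [scanStep_of_ne_nil G c q₀ _ _ n w (List.cons_ne_nil _ _)]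
    exact ⟨[false], as, j, rfl, hsuf, hj, Or.inr (Or.inl rfl)⟩
  · rw [scanStep_of_ne_nil G c q₀ _ _ n w (List.cons_ne_nil _ _)]
    exact ⟨true :: q, as, j, rfl, hsuf, hj, Or.inr (Or.inr ⟨q, rfl, hq⟩)⟩

include hw hnN in
/-- **The step stays within the growth allowance** on states of the invariant. [folklore] -/
theorem scinv_bound (k : ℕ) (s : List Bool) (hs : ScInv G c q₀ u A n w as₀ s) :
    (scanStep G c q₀ (boolPair (boolPair u A) (boolPair (encodeNat (k + 1)) s))).length ≤ s.length + (SSp G c q₀).eval (boolPair u A).length := by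
  obtain ⟨S, as, j, rfl, hsuf, hj, hS⟩ := hs
  rw [SSp_eval]
  rcases hS with rfl | rfl | ⟨q, rfl, hq⟩
  · by_cases hjlt : j < n + 1
    · by_cases hb : w.getD (j * (n + 1)) false = false
      · rw [scanStep_skip G c q₀ _ _ n w as hjlt hb, length_scEnc, length_scEnc]; simp; omega
      · have hb' : w.getD (j * (n + 1)) false = true := by simpa using hb
        by_cases hn : n = 0
        · rw [scanStep_found_zero G c q₀ _ _ n w as hjlt hb' hn, length_scEnc, length_scEnc]; simp; omega
        · cases as with
          | nil =>
            rw [scanStep_pending G c q₀ _ _ n w hjlt hb' hn, pivQueryF_rec G c q₀ u A _ hw [] [] hjlt, length_scEnc, length_scEnc]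
            have := length_pivQuery_le G c q₀ u w hjlt (by omega : n ≤ (boolPair u A).length)
              ((length_inX_le u).trans (by rw [length_boolPair]; omega))
            simp only [List.length_cons, List.length_nil]
            omega
          | cons a as' =>
            have hA := length_ansEnc_le_of_suffix' (List.suffix_cons a as')
            by_cases ha : decodeNat a = 0
            · rw [scanStep_cons_zero G c q₀ _ _ n w a as' hjlt hb' hn ha, length_scEnc, length_scEnc]; simp; omega
            · rw [scanStep_cons_found G c q₀ _ _ n w a as' hjlt hb' hn ha, length_scEnc, length_scEnc]; simp; omega
    · rw [scanStep_of_le G c q₀ _ _ n w as (not_lt.1 hjlt)]; omega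
  · rw [scanStep_of_ne_nil G c q₀ _ _ n w (List.cons_ne_nil _ _)]; omega
  · rw [scanStep_of_ne_nil G c q₀ _ _ n w (List.cons_ne_nil _ _)]; omega
where
  /-- The transcript code of a suffix is no longer (local copy for the scan). [folklore] -/
  length_ansEnc_le_of_suffix' {as as' : List (List Bool)} (h : as' <:+ as) : (ansEnc as').length ≤ (ansEnc as).length := by
    obtain ⟨pre, rfl⟩ := h
    rw [ansEnc, ansEnc, length_boolPair, length_boolPair]
    have h1 : (encList as').length ≤ (encList (pre ++ as')).length := by
      induction pre with
      | nil => simp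
      | cons b pre ih => rw [List.cons_append, encList_cons, length_boolPair]; omega
    simp [ones]
    omega

end SInvariant

/-- **The scan loop on the initial scanning state** (input `⟨u, A⟩`, `|w| = (n+1)²`, `n + 1 ≤ |inp|`): the code
of `pivScan (randMaker G c q₀ u) (wmat (n+1) w) (n+1) 0 as` at the final candidate. [cite: AaronsonArkhipovToC2013, proof of Thm. 4.3 (p. 176)] -/
theorem scanLoopF_apply (G : ℕ) (c q₀ : Polynomial ℕ) (u A : List Bool) {n : ℕ} {w : List Bool} (hw : w.length = (n + 1) * (n + 1))
    (hnN : n + 1 ≤ (boolPair u A).length) (as : List (List Bool)) :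
    scanLoopF G c q₀ (boolPair (boolPair u A) (boolPair (encodeNat (n + 1)) (scEnc w n [] as 0))) =
      boolPair (boolPair u A) (boolPair []
        (scOut w n (pivScan (randMaker G c q₀ u) (wmat (n + 1) w) (n + 1) 0 as) (scanIdx (wmat (n + 1) w) (n + 1) 0 as))) := by
  have hk : n + 1 ≤ (X + 1 : Polynomial ℕ).eval (fstF (boolPair (boolPair u A) (boolPair (encodeNat (n + 1)) (scEnc w n [] as 0)))).length := by
    rw [fstF_boolPair]; simp only [Polynomial.eval_add, Polynomial.eval_X, Polynomial.eval_one]; omega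
  rw [scanLoopF, iterate_loopStep _ _ _ _ _ hk,
    loopModel_rcapF_of_invariant (ScInv G c q₀ u A n w as) (scinv_step hw hnN) (scinv_bound hw hnN) _ _ scinv_init,
    loopModel_scanStep G c q₀ u A hw]

/-! ### The pre-phase -/

/-- **The input record of the pre-phase**: machine input, the word with its dimension, the transcript. [folklore] -/
def headRec (inp : List Bool) (n : ℕ) (w : List Bool) (as : List (List Bool)) : List Bool :=
  boolPair inp (boolPair (boolPair w (ones (n + 1))) (ansEnc as))

/-- Machine input of the head record. [folklore] -/
def hInp : List Bool → List Bool := nthF 0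
/-- The word. [folklore] -/
def hW : List Bool → List Bool := fstF ∘ nthF 1
/-- The dimension. [folklore] -/
def hK : List Bool → List Bool := sndF ∘ nthF 1
/-- The transcript. [folklore] -/
def hAS : List Bool → List Bool := sndPow 1

section HProj
variable (inp : List Bool) (n : ℕ) (w : List Bool) (as : List (List Bool))
/-- Value of `hInp`. [folklore] -/
@[simp] theorem hInp_headRec : hInp (headRec inp n w as) = inp := by simp [hInp, headRec]
/-- Value of `hW`. [folklore] -/
@[simp] theorem hW_headRec : hW (headRec inp n w as) = w := by simp [hW, headRec, nthF]
/-- Value of `hK`. [folklore] -/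
@[simp] theorem hK_headRec : hK (headRec inp n w as) = ones (n + 1) := by simp [hK, headRec, nthF]
/-- Value of `hAS`. [folklore] -/
@[simp] theorem hAS_headRec : hAS (headRec inp n w as) = ansEnc as := by simp [hAS, headRec, sndPow]
end HProj

/-- The projections are in `FP`. [cite: AroraBarak2009, §1.3] -/
theorem hproj_mem_FP : hInp ∈ FP ∧ hW ∈ FP ∧ hK ∈ FP ∧ hAS ∈ FP :=
  ⟨nthF_mem_FP 0, comp_mem_FP fstF_mem_FP (nthF_mem_FP 1), comp_mem_FP sndF_mem_FP (nthF_mem_FP 1), sndPow_mem_FP 1⟩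

/-- On the head record with input `⟨u, A⟩`: **the argument record of `querF` for the value query** —
`⟨⟨inX u, inR u⟩, ⟨matC w, block index of the site (n+1, 0, 0, 0)⟩⟩`. [cite: AaronsonArkhipovToC2013, proof of Thm. 4.3 (p. 176) with Thm. 1.1 (p. 149)] -/
def valArgF (G : ℕ) (q₀ : Polynomial ℕ) : List Bool → List Bool :=
  fanoutFn (fanoutFn (fstF ∘ fstF ∘ fstF ∘ hInp) (sndF ∘ fstF ∘ fstF ∘ hInp))
    (fanoutFn (matC ∘ hW)
      (blockIdxF G q₀ ∘ fanoutFn (fstF ∘ fstF ∘ fstF ∘ hInp) (fanoutFn (lenBinF ∘ fstF ∘ fstF ∘ sndF ∘ fstF ∘ hInp)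
        (fanoutFn (lenBinF ∘ hK) (fanoutFn (fun _ => encodeNat 0) (fanoutFn (fun _ => encodeNat 0) fun _ => encodeNat 0))))))

/-- `valArgF G q₀ ∈ FP`. [cite: AroraBarak2009, §1.3] -/
theorem valArgF_mem_FP (G : ℕ) (q₀ : Polynomial ℕ) : valArgF G q₀ ∈ FP := by
  obtain ⟨hI, hWw, hKk, _⟩ := hproj_mem_FP
  have hu : (fstF ∘ hInp) ∈ FP := comp_mem_FP fstF_mem_FP hI
  exact fanoutFn_mem_FP
    (fanoutFn_mem_FP (comp_mem_FP fstF_mem_FP (comp_mem_FP fstF_mem_FP hu)) (comp_mem_FP sndF_mem_FP (comp_mem_FP fstF_mem_FP hu)))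
    (fanoutFn_mem_FP (comp_mem_FP matC_mem_FP hWw)
      (comp_mem_FP (blockIdxF_mem_FP G q₀) (fanoutFn_mem_FP (comp_mem_FP fstF_mem_FP (comp_mem_FP fstF_mem_FP hu))
        (fanoutFn_mem_FP (comp_mem_FP lenBinF_mem_FP (comp_mem_FP fstF_mem_FP (comp_mem_FP fstF_mem_FP (comp_mem_FP sndF_mem_FP hu))))
          (fanoutFn_mem_FP (comp_mem_FP lenBinF_mem_FP hKk) (fanoutFn_mem_FP (const_mem_FP _)
            (fanoutFn_mem_FP (const_mem_FP _) (const_mem_FP _))))))))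

/-- **Value of the argument record** (`|w| = (n+1)²`). [folklore] -/
theorem valArgF_headRec (G : ℕ) (q₀ : Polynomial ℕ) (u A : List Bool) {n : ℕ} {w : List Bool} (hw : w.length = (n + 1) * (n + 1))
    (as : List (List Bool)) :
    valArgF G q₀ (headRec (boolPair u A) n w as) =
      boolPair (boolPair (inX u) (inR u))
        (boolPair (encodingIntMatrix.encode ⟨n + 1, fun a b => wmat (n + 1) w a b⟩)
          (encodeNat (inI u * (NSp G q₀).eval (inX u).length + siteIdx G q₀ (inX u).length (n + 1, 0, 0, 0)))) := by
  have hblk := blockIdxF_apply G q₀ (inX u) (inI u) (n + 1, 0, 0, 0)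
  simp only [valArgF, Function.comp_apply, fanoutFn_apply, hInp_headRec, hW_headRec, hK_headRec, fstF_boolPair, lenBinF_apply,
    matC_wmat w hw]
  rw [show (ones (n + 1)).length = n + 1 by simp [ones]]
  dsimp only at hblk
  rw [← hblk]
  rfl

/-- On the head record: **the value query** of `randMaker G c q₀ u` at the site `(n+1, 0, 0, 0)`. [cite: AaronsonArkhipovToC2013, proof of Thm. 4.3 (p. 176) with Thm. 1.1 (p. 149)] -/
def valQueryF (G : ℕ) (c q₀ : Polynomial ℕ) : List Bool → List Bool := querF G c q₀ ∘ valArgF G q₀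

/-- `valQueryF G c q₀ ∈ FP`. [cite: AroraBarak2009, §1.3] -/
theorem valQueryF_mem_FP (G : ℕ) (c q₀ : Polynomial ℕ) : valQueryF G c q₀ ∈ FP := comp_mem_FP (querF_mem_FP G c q₀) (valArgF_mem_FP G q₀)

/-- **Value of the value query brick** (`|w| = (n+1)²`). [cite: AaronsonArkhipovToC2013, proof of Thm. 4.3 (p. 176) with Thm. 1.1 (p. 149)] -/
theorem valQueryF_headRec (G : ℕ) (c q₀ : Polynomial ℕ) (u A : List Bool) {n : ℕ} {w : List Bool} (hw : w.length = (n + 1) * (n + 1))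
    (as : List (List Bool)) :
    valQueryF G c q₀ (headRec (boolPair u A) n w as) = randMaker G c q₀ u (n + 1, 0, 0, 0) ⟨n + 1, fun a b => wmat (n + 1) w a b⟩ := by
  rw [valQueryF, Function.comp_apply, valArgF_headRec G q₀ u A hw, querF_eq_coinMap]
  rfl

/-- On the head record: **the initial record of the scan loop** (counter `bin (n+1)`, scanning from row `0`
on the transcript without its first answer). [folklore] -/
def scanInitF : List Bool → List Bool :=
  fanoutFn hInp (fanoutFn (lenBinF ∘ hK) (fanoutFn (fun _ => []) (fanoutFn (ansTlF ∘ hAS) (fanoutFn (fun _ => []) (fanoutFn hW hK)))))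

/-- Value of the initial scan record. [folklore] -/
theorem scanInitF_headRec (inp : List Bool) (n : ℕ) (w : List Bool) (a : List Bool) (as : List (List Bool)) :
    scanInitF (headRec inp n w (a :: as)) = boolPair inp (boolPair (encodeNat (n + 1)) (scEnc w n [] as 0)) := by
  simp [scanInitF, scEnc, ones]

/-- `scanInitF ∈ FP`. [cite: AroraBarak2009, §1.3] -/
theorem scanInitF_mem_FP : scanInitF ∈ FP := by
  obtain ⟨hI, hWw, hKk, hA⟩ := hproj_mem_FP
  exact fanoutFn_mem_FP hI (fanoutFn_mem_FP (comp_mem_FP lenBinF_mem_FP hKk) (fanoutFn_mem_FP (const_mem_FP _)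
    (fanoutFn_mem_FP (comp_mem_FP ansTlF_mem_FP hA) (fanoutFn_mem_FP (const_mem_FP _) (fanoutFn_mem_FP hWw hKk)))))

/-- On `⟨head record, scan loop output⟩`: **the read-out of the scan** — still scanning (no pivot): exit `00`;
found: `0` with the candidate and the first value `canonF a`; else the pending status. [folklore] -/
def headOutF : List Bool → List Bool :=
  let fs := sndPow 1 ∘ sndF
  iteFn (isNilFn ∘ sS ∘ fs)
    (fanoutFn (fun _ => [false, false]) (fanoutFn (sAS ∘ fs) fun _ => boolPair [] []))
    (iteFn (eqPairFn ∘ fanoutFn (sS ∘ fs) fun _ => [false])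
      (fanoutFn (fun _ => [false]) (fanoutFn (sAS ∘ fs) (fanoutFn (sJ ∘ fs) (canonF ∘ ansHdF ∘ hAS ∘ fstF))))
      (fanoutFn (sS ∘ fs) (fanoutFn (sAS ∘ fs) fun _ => boolPair [] [])))

/-- `headOutF ∈ FP`. [cite: AroraBarak2009, §1.3] -/
theorem headOutF_mem_FP : headOutF ∈ FP := by
  obtain ⟨hS, hASs, hJ, _, _⟩ := sproj_mem_FP
  have hfs : (sndPow 1 ∘ sndF) ∈ FP := comp_mem_FP (sndPow_mem_FP 1) sndF_mem_FP
  exact iteFn_mem_FP (comp_mem_FP isNilFn_mem_FP (comp_mem_FP hS hfs))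
    (fanoutFn_mem_FP (const_mem_FP _) (fanoutFn_mem_FP (comp_mem_FP hASs hfs) (const_mem_FP _)))
    (iteFn_mem_FP (comp_mem_FP eqPairFn_mem_FP (fanoutFn_mem_FP (comp_mem_FP hS hfs) (const_mem_FP _)))
      (fanoutFn_mem_FP (const_mem_FP _) (fanoutFn_mem_FP (comp_mem_FP hASs hfs) (fanoutFn_mem_FP (comp_mem_FP hJ hfs)
        (comp_mem_FP canonF_mem_FP (comp_mem_FP ansHdF_mem_FP (comp_mem_FP (sndPow_mem_FP 1) fstF_mem_FP))))))
      (fanoutFn_mem_FP (comp_mem_FP hS hfs) (fanoutFn_mem_FP (comp_mem_FP hASs hfs) (const_mem_FP _))))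

/-- **The code of the outcome of the pre-phase** (`replay_levelPre`): pending `1 q` (transcript exhausted),
exit `00` (value `0` or no pivot) with the leftover transcript, pivot `p` with first value `v₀`
(status `0`, `1ᵖ`, `bin v₀`). [folklore] -/
def headOut (n : ℕ) : (List Bool ⊕ (Option (Fin (n + 1) × ℕ) × List (List Bool))) → List Bool
  | Sum.inl q => boolPair (true :: q) (boolPair (ansEnc []) (boolPair [] []))
  | Sum.inr (none, as) => boolPair [false, false] (boolPair (ansEnc as) (boolPair [] []))
  | Sum.inr (some (p, v0), as) => boolPair [false] (boolPair (ansEnc as) (boolPair (ones p) (encodeNat v0)))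

/-- **The pre-phase of a level**: pending value query if no answer; exit on first answer `0`; else the scan. [cite: AaronsonArkhipovToC2013, proof of Thm. 4.3 (p. 176)] -/
def headF (G : ℕ) (c q₀ : Polynomial ℕ) : List Bool → List Bool :=
  iteFn (isNilFn ∘ fstF ∘ hAS)
    (fanoutFn (List.cons true ∘ valQueryF G c q₀) (fanoutFn hAS fun _ => boolPair [] []))
    (iteFn (isNilFn ∘ canonF ∘ ansHdF ∘ hAS)
      (fanoutFn (fun _ => [false, false]) (fanoutFn (ansTlF ∘ hAS) fun _ => boolPair [] []))
      (headOutF ∘ fanoutFn id (scanLoopF G c q₀ ∘ scanInitF)))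

/-- **`headF G c q₀ ∈ FP`.** [cite: AroraBarak2009, §1.3] -/
theorem headF_mem_FP (G : ℕ) (c q₀ : Polynomial ℕ) : headF G c q₀ ∈ FP := by
  have hA : hAS ∈ FP := hproj_mem_FP.2.2.2
  exact iteFn_mem_FP (comp_mem_FP isNilFn_mem_FP (comp_mem_FP fstF_mem_FP hA))
    (fanoutFn_mem_FP (comp_mem_FP (cons_mem_FP true) (valQueryF_mem_FP G c q₀)) (fanoutFn_mem_FP hA (const_mem_FP _)))
    (iteFn_mem_FP (comp_mem_FP isNilFn_mem_FP (comp_mem_FP canonF_mem_FP (comp_mem_FP ansHdF_mem_FP hA)))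
      (fanoutFn_mem_FP (const_mem_FP _) (fanoutFn_mem_FP (comp_mem_FP ansTlF_mem_FP hA) (const_mem_FP _)))
      (comp_mem_FP headOutF_mem_FP (fanoutFn_mem_FP OracleCompose.id_mem_FP (comp_mem_FP (scanLoopF_mem_FP G c q₀) scanInitF_mem_FP))))

/-- Read-out of a scan that found nothing. [folklore] -/
theorem headOutF_none (hr inp : List Bool) (w : List Bool) (n : ℕ) (as : List (List Bool)) (j : ℕ) :
    headOutF (boolPair hr (boolPair inp (boolPair [] (scEnc w n [] as j)))) = boolPair [false, false] (boolPair (ansEnc as) (boolPair [] [])) := by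
  rw [headOutF, iteFn_apply (b := true) (by simp [isNilFn, sndPow])]
  simp [sndPow]

/-- Read-out of a scan that found a pivot. [folklore] -/
theorem headOutF_found (inp : List Bool) (w : List Bool) (n : ℕ) (a : List Bool) (as₀ as : List (List Bool)) (p : ℕ) :
    headOutF (boolPair (headRec inp n w (a :: as₀)) (boolPair inp (boolPair [] (scEnc w n [false] as p)))) =
      boolPair [false] (boolPair (ansEnc as) (boolPair (ones p) (encodeNat (decodeNat a)))) := by
  rw [headOutF, iteFn_apply (b := false) (by simp [isNilFn, sndPow]), iteFn_apply (b := true) (by simp [sndPow, eqPairFn_boolPair])]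
  simp [sndPow, canonF_eq_encodeNat_decodeNat, headRec, hAS]

/-- Read-out of a pending scan. [folklore] -/
theorem headOutF_pending (hr inp : List Bool) (w : List Bool) (n : ℕ) (q : List Bool) (as : List (List Bool)) (j : ℕ) :
    headOutF (boolPair hr (boolPair inp (boolPair [] (scEnc w n (true :: q) as j)))) = boolPair (true :: q) (boolPair (ansEnc as) (boolPair [] [])) := by
  rw [headOutF, iteFn_apply (b := false) (by simp [isNilFn, sndPow]), iteFn_apply (b := false) (by simp [sndPow, eqPairFn_boolPair])]
  simp [sndPow]

/-- **The pre-phase brick realises `levelPre`** (input `⟨u, A⟩`, `|w| = (n+1)²`, `n + 1 ≤ |inp|`):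
`headF (headRec ⟨u, A⟩ n w as) = headOut n (replay (levelPre (randMaker G c q₀ u) (wmat (n+1) w)) as)`. [cite: AaronsonArkhipovToC2013, proof of Thm. 4.3 (p. 176)] -/
theorem headF_apply (G : ℕ) (c q₀ : Polynomial ℕ) (u A : List Bool) {n : ℕ} {w : List Bool} (hw : w.length = (n + 1) * (n + 1))
    (hnN : n + 1 ≤ (boolPair u A).length) (as : List (List Bool)) :
    headF G c q₀ (headRec (boolPair u A) n w as) = headOut n (replay (levelPre (randMaker G c q₀ u) (wmat (n + 1) w)) as) := by
  cases as with
  | nil =>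
    rw [replay_levelPre, headF, iteFn_apply (b := true) (by simp [isNilFn, ansEnc, ones])]
    simp only [if_true, fanoutFn_apply, Function.comp_apply, valQueryF_headRec G c q₀ u A hw, hAS_headRec]
    rfl
  | cons a as' =>
    rw [replay_levelPre, headF, iteFn_apply (b := false) (by simp [isNilFn, ansEnc, ones])]
    dsimp only
    by_cases ha : decodeNat a = 0
    · rw [iteFn_apply (b := true) (by simp [isNilFn, canonF_eq_encodeNat_decodeNat, ha, (by decide : encodeNat 0 = [])]), if_pos ha]
      simp [headOut]
    · have hne : encodeNat (decodeNat a) ≠ [] := fun h => ha (by rw [← bitsToNat_encodeNat (decodeNat a), h]; rfl)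
      rw [iteFn_apply (b := false) (by simp [isNilFn, canonF_eq_encodeNat_decodeNat, hne]), if_neg ha]
      simp only [Bool.false_eq_true, if_false, Function.comp_apply, fanoutFn_apply, id, scanInitF_headRec,
        scanLoopF_apply G c q₀ u A hw hnN]
      rcases pivScan (randMaker G c q₀ u) (wmat (n + 1) w) (n + 1) 0 as' with q | ⟨_ | p, as''⟩
      · exact headOutF_pending _ _ w n q [] _
      · exact headOutF_none _ _ w n as'' _
      · exact headOutF_found _ w n a as' as'' p

end PerSearch

end Literature.Computability.QuantumComplexity

end
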